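import Mathlib
import Summits.MatrixMultiplication.MatrixMultiplication.Theorems.SnSubsetDichotomyNoThresholdSubsetTriplePlancherelStepDefs

/-!
# (F2b): the J-increments of the two successor cells after one Plancherel growth step

Stub `incr_insert_succ` of line `klr-graded-polynomial-method` (crux `SnSubsetDichotomy.NoThresholdSubsetTriple`,
stmt-MatrixMultiplication-8302; lead c7 report
`Cruxes/NoThresholdSubsetTriple/Lines/klr_graded_polynomial_method-lead-c7.md` app. A, item (F2b)).

Let `ν ⊆ ℕ × ℕ` be a finite lower set (a Young diagram, cells `(row, col)`) and `z = (r, c)` an addable node.  After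
the growth step `ν ↦ insert z ν` the two cells that may become corners next are the successors `(r, c + 1)` and
`(r + 1, c)`; their increments `x_y = R(row y) − C(col y)` (`PlancherelStep.incr`) are
`incr (insert z ν) (r, c + 1) = incr ν z + χ^c_{c+1}(ν)` and `incr (insert z ν) (r + 1, c) = incr ν z − χ_{r+1}(ν)`.

Proof.  Inserting `z` changes the row lengths only in row `r` and the column lengths only in column `c`, so every
row charge `χ_i` with `i ≠ r` and every column charge `χ^c_j` with `j ≠ c` is unchanged, and the tails
`R(r') = Σ_{i > r'} χ_i` (`r' ≥ r`) and `C(c') = Σ_{j > c'} χ^c_j` (`c' ≥ c`) only see such indices.  The finite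
index ranges in `chargeBelow` / `chargeRight` (`≤ |ν|`, resp. `≤ |ν| + 1` after the insertion) are harmless: in a
lower set every cell `(i, j)` has `i, j < |ν|` (the column segment above it and the row segment left of it lie in
the set), so rows and columns of index `≥ |ν|` are empty and carry no charge, and the tails may be summed over any
range reaching `|ν|`.  Finally `R(r) = χ_{r+1} + R(r + 1)` and `C(c) = χ^c_{c+1} + C(c + 1)` (peel one term).
-/

open scoped BigOperators
open Literature.RepresentationTheory.FiniteGroups (addableNodes IsAddableNode)

namespace Summit.MatrixMultiplication.MatrixMultiplication.Theorems

open PlancherelStep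

set_option linter.dupNamespace false in
/-- In a lower set a cell `(i, j)` drags the column segment `(0, j), …, (i, j)` and the row segment
`(i, 0), …, (i, j)` into the set, so `i < |ν|` and `j < |ν|`. [folklore] -/
private theorem lt_card_of_mem {ν : Finset (ℕ × ℕ)} (hν : IsLowerSet (ν : Set (ℕ × ℕ))) {i j : ℕ}
    (h : (i, j) ∈ ν) : i < ν.card ∧ j < ν.card := by
  constructor
  · have hsub : (Finset.range (i + 1)).image (fun k => (k, j)) ⊆ ν := by
      intro y hy
      simp only [Finset.mem_image, Finset.mem_range] at hy
      obtain ⟨k, hk, rfl⟩ := hy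
      exact Finset.mem_coe.1 (hν (Prod.mk_le_mk.2 ⟨by omega, le_rfl⟩) (Finset.mem_coe.2 h))
    have hcard := Finset.card_le_card hsub
    rw [Finset.card_image_of_injective _ (Prod.mk_left_injective j), Finset.card_range] at hcard
    omega
  · have hsub : (Finset.range (j + 1)).image (Prod.mk i) ⊆ ν := by
      intro y hy
      simp only [Finset.mem_image, Finset.mem_range] at hy
      obtain ⟨k, hk, rfl⟩ := hy
      exact Finset.mem_coe.1 (hν (Prod.mk_le_mk.2 ⟨le_rfl, by omega⟩) (Finset.mem_coe.2 h))
    have hcard := Finset.card_le_card hsub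
    rw [Finset.card_image_of_injective _ (Prod.mk_right_injective i), Finset.card_range] at hcard
    omega

set_option linter.dupNamespace false in
/-- Rows of index `≥ |ν|` of a lower set are empty, so they carry no charge. [folklore] -/
private theorem rowCharge_eq_zero_of_card_le {ν : Finset (ℕ × ℕ)} (hν : IsLowerSet (ν : Set (ℕ × ℕ)))
    {i : ℕ} (hi : ν.card ≤ i) : rowCharge ν i = 0 := by
  have h : rowLen ν i = 0 := by
    rw [rowLen, Finset.card_eq_zero, Finset.filter_eq_empty_iff]
    rintro ⟨a, b⟩ hx (rfl : a = i)
    exact absurd (lt_card_of_mem hν hx).1 (not_lt.2 hi)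
  rw [rowCharge, h, if_neg Nat.not_odd_zero]

set_option linter.dupNamespace false in
/-- Columns of index `≥ |ν|` of a lower set are empty, so they carry no charge. [folklore] -/
private theorem colCharge_eq_zero_of_card_le {ν : Finset (ℕ × ℕ)} (hν : IsLowerSet (ν : Set (ℕ × ℕ)))
    {j : ℕ} (hj : ν.card ≤ j) : colCharge ν j = 0 := by
  have h : colLen ν j = 0 := by
    rw [colLen, Finset.card_eq_zero, Finset.filter_eq_empty_iff]
    rintro ⟨a, b⟩ hx (rfl : b = j)
    exact absurd (lt_card_of_mem hν hx).2 (not_lt.2 hj)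
  rw [colCharge, h, if_neg Nat.not_odd_zero]

set_option linter.dupNamespace false in
/-- The tail `R(r)` may be summed over any index range reaching `|ν|`. [folklore] -/
private theorem chargeBelow_eq_sum {ν : Finset (ℕ × ℕ)} (hν : IsLowerSet (ν : Set (ℕ × ℕ))) {N : ℕ}
    (hN : ν.card ≤ N) (r : ℕ) :
    chargeBelow ν r = ∑ i ∈ (Finset.range (N + 1)).filter (fun i => r < i), rowCharge ν i := by
  rw [chargeBelow]
  refine Finset.sum_subset (fun i hi => ?_) (fun i hi hi' => ?_)
  · simp only [Finset.mem_filter, Finset.mem_range] at hi ⊢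
    exact ⟨by omega, hi.2⟩
  · simp only [Finset.mem_filter, Finset.mem_range, not_and'] at hi hi'
    have := hi' hi.2
    exact rowCharge_eq_zero_of_card_le hν (by omega)

set_option linter.dupNamespace false in
/-- The tail `C(c)` may be summed over any index range reaching `|ν|`. [folklore] -/
private theorem chargeRight_eq_sum {ν : Finset (ℕ × ℕ)} (hν : IsLowerSet (ν : Set (ℕ × ℕ))) {N : ℕ}
    (hN : ν.card ≤ N) (c : ℕ) :
    chargeRight ν c = ∑ j ∈ (Finset.range (N + 1)).filter (fun j => c < j), colCharge ν j := by
  rw [chargeRight]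
  refine Finset.sum_subset (fun j hj => ?_) (fun j hj hj' => ?_)
  · simp only [Finset.mem_filter, Finset.mem_range] at hj ⊢
    exact ⟨by omega, hj.2⟩
  · simp only [Finset.mem_filter, Finset.mem_range, not_and'] at hj hj'
    have := hj' hj.2
    exact colCharge_eq_zero_of_card_le hν (by omega)

set_option linter.dupNamespace false in
/-- Peeling the first term of the row tail: `R(r) = χ_{r+1} + R(r + 1)`. [folklore] -/
private theorem chargeBelow_eq_add {ν : Finset (ℕ × ℕ)} (hν : IsLowerSet (ν : Set (ℕ × ℕ))) (r : ℕ) :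
    chargeBelow ν r = rowCharge ν (r + 1) + chargeBelow ν (r + 1) := by
  have hN : ν.card ≤ ν.card + (r + 1) := Nat.le_add_right _ _
  rw [chargeBelow_eq_sum hν hN r, chargeBelow_eq_sum hν hN (r + 1)]
  have h : (Finset.range (ν.card + (r + 1) + 1)).filter (fun i => r < i) =
      insert (r + 1) ((Finset.range (ν.card + (r + 1) + 1)).filter (fun i => r + 1 < i)) := by
    ext i
    simp only [Finset.mem_filter, Finset.mem_range, Finset.mem_insert]
    omega
  rw [h, Finset.sum_insert (by simp)]

set_option linter.dupNamespace false in
/-- Peeling the first term of the column tail: `C(c) = χ^c_{c+1} + C(c + 1)`. [folklore] -/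
private theorem chargeRight_eq_add {ν : Finset (ℕ × ℕ)} (hν : IsLowerSet (ν : Set (ℕ × ℕ))) (c : ℕ) :
    chargeRight ν c = colCharge ν (c + 1) + chargeRight ν (c + 1) := by
  have hN : ν.card ≤ ν.card + (c + 1) := Nat.le_add_right _ _
  rw [chargeRight_eq_sum hν hN c, chargeRight_eq_sum hν hN (c + 1)]
  have h : (Finset.range (ν.card + (c + 1) + 1)).filter (fun j => c < j) =
      insert (c + 1) ((Finset.range (ν.card + (c + 1) + 1)).filter (fun j => c + 1 < j)) := by
    ext j
    simp only [Finset.mem_filter, Finset.mem_range, Finset.mem_insert]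
    omega
  rw [h, Finset.sum_insert (by simp)]

set_option linter.dupNamespace false in
/-- Inserting a cell changes no row length outside its row. [folklore] -/
private theorem rowLen_insert_of_ne (ν : Finset (ℕ × ℕ)) {a b i : ℕ} (h : i ≠ a) :
    rowLen (insert (a, b) ν) i = rowLen ν i := by
  unfold rowLen
  rw [Finset.filter_insert, if_neg fun e => h e.symm]

set_option linter.dupNamespace false in
/-- Inserting a cell changes no column length outside its column. [folklore] -/
private theorem colLen_insert_of_ne (ν : Finset (ℕ × ℕ)) {a b j : ℕ} (h : j ≠ b) :
    colLen (insert (a, b) ν) j = colLen ν j := by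
  unfold colLen
  rw [Finset.filter_insert, if_neg fun e => h e.symm]

set_option linter.dupNamespace false in
/-- Below a row of index `≥ a`, inserting a new cell `(a, b)` does not change the row tail. [folklore] -/
private theorem chargeBelow_insert {ν : Finset (ℕ × ℕ)} (hν : IsLowerSet (ν : Set (ℕ × ℕ))) {a b : ℕ}
    (hz : (a, b) ∉ ν) (r : ℕ) (hr : a ≤ r) : chargeBelow (insert (a, b) ν) r = chargeBelow ν r := by
  rw [chargeBelow_eq_sum hν (Nat.le_add_right ν.card 1) r, chargeBelow, Finset.card_insert_of_notMem hz]
  refine Finset.sum_congr rfl fun i hi => ?_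
  simp only [Finset.mem_filter, Finset.mem_range] at hi
  unfold rowCharge
  rw [rowLen_insert_of_ne ν (by omega)]

set_option linter.dupNamespace false in
/-- Right of a column of index `≥ b`, inserting a new cell `(a, b)` does not change the column tail. [folklore] -/
private theorem chargeRight_insert {ν : Finset (ℕ × ℕ)} (hν : IsLowerSet (ν : Set (ℕ × ℕ))) {a b : ℕ}
    (hz : (a, b) ∉ ν) (c : ℕ) (hc : b ≤ c) : chargeRight (insert (a, b) ν) c = chargeRight ν c := by
  rw [chargeRight_eq_sum hν (Nat.le_add_right ν.card 1) c, chargeRight, Finset.card_insert_of_notMem hz]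
  refine Finset.sum_congr rfl fun j hj => ?_
  simp only [Finset.mem_filter, Finset.mem_range] at hj
  unfold colCharge
  rw [colLen_insert_of_ne ν (by omega)]

set_option linter.dupNamespace false in
/-- **(F2b)** After the Plancherel growth step at the addable node `z = (r, c)` of the Young diagram `ν`, the
increments of the two successor cells are `x_{(r, c+1)}(ν ∪ z) = x_z(ν) + χ^c_{c+1}(ν)` and
`x_{(r+1, c)}(ν ∪ z) = x_z(ν) − χ_{r+1}(ν)`. [folklore] -/
theorem incr_insert_succ : ∀ (ν : Finset (ℕ × ℕ)), IsLowerSet (ν : Set (ℕ × ℕ)) →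
    ∀ (z : ℕ × ℕ), z ∈ addableNodes ν →
      incr (insert z ν) (z.1, z.2 + 1) = incr ν z + colCharge ν (z.2 + 1) ∧
      incr (insert z ν) (z.1 + 1, z.2) = incr ν z - rowCharge ν (z.1 + 1) := by
  rintro ν hν ⟨r, c⟩ hz
  have hz' : (r, c) ∉ ν := (Literature.RepresentationTheory.FiniteGroups.mem_addableNodes.1 hz).1
  simp only [incr]
  rw [chargeBelow_insert hν hz' r le_rfl, chargeBelow_insert hν hz' (r + 1) (Nat.le_add_right r 1),
    chargeRight_insert hν hz' (c + 1) (Nat.le_add_right c 1), chargeRight_insert hν hz' c le_rfl,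
    chargeBelow_eq_add hν r, chargeRight_eq_add hν c]
  constructor <;> ring

end Summit.MatrixMultiplication.MatrixMultiplication.Theorems
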